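import Summits.BirchSwinnertonDyer.BirchSwinnertonDyer.Theorems.ManinLocalTwoThreeSigmaSquareRootMonodromy
import HarnessLib

/-!
# Square-root monodromy on the upper half-plane for ARBITRARY holomorphic carriers (S4₂ generalised)
(route `ManinLocalTwoThree`, crux C2 `ManinOddAtFour` stmt-BirchSwinnertonDyer-22967; cell bsd-f2-manin, prover p2 gen 20; the analytic engine of
E-an-237 `KummerShimuraTwo.EvenKummerRepCongruencePeriodic`, `--supports stmt-BirchSwinnertonDyer-22967`)

p2 g16's S4₂ `SigmaSquareRoot.sigmaSqRootMonodromy` proves: if `F(τ)² = C·(t_s(τ)·V(w(τ)))²·G(τ)²` near the base point for MODULAR FORMS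
`F, G ∈ M_k(Γ₀(M))`, `G ≠ 0`, then the `σ`-square root `V = V_{a,e}` is periodic under `c·{∞, γ∞}_f` for every `γ ∈ Γ₀(N) ∩ Γ₀(M)`.  Its
proof uses of `F, G` only: holomorphy on `ℍ`, `G ≢ 0`, and — at ONE generic point `τ₁` — the automorphy `F(γτ₁) = J·F(τ₁)`, `G(γτ₁) = J·G(τ₁)`
with the SAME non-zero factor `J`.  Here that proof is re-run VERBATIM for this weaker input:

* `eventually_ne_zero_of_mdifferentiable` — a holomorphic `G : ℍ → ℂ` with `G τ₀ ≠ 0` somewhere is non-zero on a punctured neighbourhood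
  of every point (identity theorem on the connected half-plane; the tree's `eventually_modularForm_ne_zero` for forms);
* **`sigmaSqRootMonodromy_of_automorphy`** — `F, G : ℍ → ℂ` holomorphic, `G ≢ 0`, `C ≠ 0`, `F² = C·(t_s·V(w))²·G²` for `Im τ > B` off the
  lattice, and for the given `γ ∈ Γ₀(N)`: `∀ τ, ∃ J ≠ 0, F(γτ) = J·F(τ) ∧ G(γτ) = J·G(τ)`.  Then `V(w₀ + c·{∞,γ∞}_f) = V(w₀)` for all `w₀`.

USE (E-an-237): `F = η_{r/2}·F_A`, `G = G_B` where `A/B = F̂_A/Ĝ_B` is the cuspidal Kummer representative's modular function and `η_{r/2}` is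
`Γ(8N)`-invariant (p2 g20 `EtaHalfNewman.etaQuotientInvariantOfHalfNewman_holds`), `γ ∈ Γ₀(N) ∩ Γ(8N)`, `J = j(γ,τ)^k`.
HONEST FRAMING: complex analysis only (the landed S4₂ proof with two hypotheses weakened); nothing about C2, Manin's conjecture or BSD is proved.
[cite: WhittakerWatson1927, §20.421 (σ quasi-periodicity)] [cite: Manin1972, Prop. 1.4 (u(γτ) − u(τ) = {∞, γ∞}; shape)]
-/

set_option autoImplicit false
-- lint-debt: the directory name repeats the summit name (sibling precedent `ManinLocalTwoThreeSigmaSquareRootMonodromy.lean`)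
set_option linter.dupNamespace false

noncomputable section

open Complex Filter Topology
open scoped PeriodPair UpperHalfPlane Manifold
open WeierstrassCurve Literature.NumberTheory.EllipticCurves Literature.NumberTheory.EllipticCurves.ModularForms
open Summit.BirchSwinnertonDyer.Rank1Residual.ManinAdditive.CuspidalKummer
open Summit.BirchSwinnertonDyer.Rank1Residual.ManinAdditive.KummerCubeMonodromy
open Summit.BirchSwinnertonDyer.BirchSwinnertonDyer.Theorems.ManinLocalTwoThree.KummerCubeSigmaLeaves
open Summit.BirchSwinnertonDyer.BirchSwinnertonDyer.Theorems.ManinLocalTwoThree.SigmaSquareRoot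

namespace Summit.BirchSwinnertonDyer.BirchSwinnertonDyer.Theorems.ManinLocalTwoThree.EvenKummerCongruence

open UpperHalfPlane CongruenceSubgroup
open scoped MatrixGroups ModularForm

/-- **Generic non-vanishing** of a holomorphic `G : ℍ → ℂ` that is not identically zero, on a punctured neighbourhood of any point of
the upper half-plane (identity theorem on the connected half-plane). [folklore] -/
theorem eventually_ne_zero_of_mdifferentiable (G : ℍ → ℂ) (hG : MDifferentiable 𝓘(ℂ) 𝓘(ℂ) G) (hG0 : ∃ τ : ℍ, G τ ≠ 0)
    {z₀ : ℂ} (hz₀ : 0 < z₀.im) : ∀ᶠ z in 𝓝[≠] z₀, G (ofComplex z) ≠ 0 := by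
  have hdiff : DifferentiableOn ℂ (G ∘ ofComplex) {z : ℂ | 0 < z.im} := UpperHalfPlane.mdifferentiable_iff.mp hG
  have han : AnalyticOnNhd ℂ (G ∘ ofComplex) {z : ℂ | 0 < z.im} := hdiff.analyticOnNhd isOpen_upperHalfPlaneSet
  rcases (han z₀ hz₀).eventually_eq_zero_or_eventually_ne_zero with h | h
  · exfalso
    obtain ⟨τ, hτ⟩ := hG0
    apply hτ
    have hEq : Set.EqOn (G ∘ ofComplex) 0 {z : ℂ | 0 < z.im} :=
      han.eqOn_zero_of_preconnected_of_eventuallyEq_zero convex_setOf_im_pos.isPreconnected hz₀ h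
    have := hEq τ.im_pos
    simpa [ofComplex_apply] using this
  · exact h

/-- **S4₂ for arbitrary holomorphic carriers — square-root monodromy from ONE automorphy.**  Let `F, G : ℍ → ℂ` be holomorphic, `G ≢ 0`,
`C ≠ 0`, and suppose `F(τ)² = C·(t_s(τ)·V(w(τ)))²·G(τ)²` whenever `Im τ > B` and `w(τ) = c·u(τ) ∉ Λ` (`V = sigmaSqRoot D.L a e`,
`t_s = shortT D`).  If `γ ∈ Γ₀(N)` acts on `F` and `G` through the same non-vanishing factor (`F(γτ) = J_τ·F(τ)`, `G(γτ) = J_τ·G(τ)`,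
`J_τ ≠ 0`, for every `τ`), then `V` is periodic under `c·{∞, γ∞}_f`.  Proof VERBATIM p2 g16's `sigmaSqRootMonodromy` (global square root
`A = κ₀B` on the connected half-plane, then the two linear relations at a generic `τ₁` and at `γτ₁`). [cite: Manin1972, Prop. 1.4 (shape)] -/
theorem sigmaSqRootMonodromy_of_automorphy
    (W : WeierstrassCurve ℚ) [W.IsElliptic] [W.IsGloballyMinimal] {N : ℕ} [NeZero N]
    (D : ModularParametrizationData W N) (a e : ℂ) (F G : ℍ → ℂ)
    (hFd : MDifferentiable 𝓘(ℂ) 𝓘(ℂ) F) (hGd : MDifferentiable 𝓘(ℂ) 𝓘(ℂ) G) (hG : ∃ τ : ℍ, G τ ≠ 0)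
    (C : ℂ) (B : ℝ) (hC : C ≠ 0)
    (hhyp : ∀ τ : ℍ, B < τ.im → (D.c : ℂ) * eichlerIntegral D.f τ ∉ D.L.lattice →
      F τ ^ 2 = C * (shortT D τ * sigmaSqRoot D.L a e ((D.c : ℂ) * eichlerIntegral D.f τ)) ^ 2 * G τ ^ 2)
    (γ : Gamma0 N)
    (hJ : ∀ τ : ℍ, ∃ J : ℂ, J ≠ 0 ∧ F ((γ : SL(2, ℤ)) • τ) = J * F τ ∧ G ((γ : SL(2, ℤ)) • τ) = J * G τ) :
    ∀ w₀ : ℂ, sigmaSqRoot D.L a e (w₀ + (D.c : ℂ) * cuspSymbol D.f γ) = sigmaSqRoot D.L a e w₀ := by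
  intro w₀
  by_cases hc0 : (D.c : ℂ) = 0
  · rw [hc0, zero_mul, add_zero]
  -- notation
  obtain ⟨c, hc⟩ : ∃ c : ℂ, c = (D.c : ℂ) := ⟨_, rfl⟩
  obtain ⟨f, hf⟩ : ∃ f : CuspForm (Gamma0 N) 2, f = D.f := ⟨_, rfl⟩
  obtain ⟨L, hL⟩ : ∃ L : PeriodPair, L = D.L := ⟨_, rfl⟩
  rw [← hc] at hc0
  rw [← hc, ← hf, ← hL] at hhyp ⊢
  have hμ : c * cuspSymbol f γ ∈ L.lattice := by
    rw [hc, hf, hL]; exact D.smul_periodLattice_le _ (cuspSymbol_mem_periodLattice D.f γ)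
  obtain ⟨μ, hμdef⟩ : ∃ μ : ℂ, μ = c * cuspSymbol f γ := ⟨_, rfl⟩
  rw [← hμdef] at hμ ⊢
  obtain ⟨ρ, hρ0, hρ⟩ := sigmaSqRoot_add_of_mem_lattice L a e hμ
  rw [hρ]
  suffices hρ1 : ρ = 1 by rw [hρ1, one_mul]
  have hf0 : f ≠ 0 := by rw [hf]; exact D.isNewformOf.1.ne_zero
  -- entire `P₂ = ℘σ²`, `P₃ = ℘'σ³`
  obtain ⟨P₂, P₃, hP₂d, hP₃d, hP₂, hP₃⟩ := exists_entire_weierstrassP_sigma L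
  have hσd : Differentiable ℂ L.weierstrassSigma := L.differentiable_weierstrassSigma_holds
  have hσne : ∀ w, w ∉ L.lattice → L.weierstrassSigma w ≠ 0 := fun w hw h ↦
    hw ((L.weierstrassSigma_eq_zero_iff_holds w).mp h)
  -- the holomorphic functions of the complex variable on `U = {im > 0}`
  obtain ⟨U, hUdef⟩ : ∃ U : Set ℂ, U = {z : ℂ | 0 < z.im} := ⟨_, rfl⟩
  have hUo : IsOpen U := by rw [hUdef]; exact isOpen_upperHalfPlaneSet
  have hconn : IsPreconnected U := by rw [hUdef]; exact convex_setOf_im_pos.isPreconnected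
  obtain ⟨v, hvdef⟩ : ∃ v : ℂ → ℂ, v = fun z ↦ c * eichlerIntegral f (ofComplex z) := ⟨_, rfl⟩
  obtain ⟨Ac, hAdef⟩ : ∃ Ac : ℂ → ℂ, Ac = fun z ↦ F (ofComplex z) * (c * P₃ (v z)) := ⟨_, rfl⟩
  obtain ⟨Bc, hBdef⟩ : ∃ Bc : ℂ → ℂ, Bc = fun z ↦
      -2 * G (ofComplex z) * (P₂ (v z) * cexp (e * v z / 2) * L.weierstrassSigma (v z - a)) := ⟨_, rfl⟩
  have hv : DifferentiableOn ℂ v U := by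
    rw [hvdef, hUdef]; exact (differentiableOn_eichlerIntegral_comp_ofComplex f).const_mul c
  have hFc : DifferentiableOn ℂ (F ∘ ofComplex) U := by
    rw [hUdef]; exact UpperHalfPlane.mdifferentiable_iff.mp hFd
  have hGc : DifferentiableOn ℂ (G ∘ ofComplex) U := by
    rw [hUdef]; exact UpperHalfPlane.mdifferentiable_iff.mp hGd
  have hAc : DifferentiableOn ℂ Ac U := by
    rw [hAdef]
    exact hFc.mul (((hP₃d.comp_differentiableOn hv)).const_mul c)
  have hBc : DifferentiableOn ℂ Bc U := by
    rw [hBdef]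
    exact (hGc.const_mul (-2)).mul ((((hP₂d.comp_differentiableOn hv)).mul
      (((hv.const_mul e).div_const 2).cexp)).mul (hσd.comp_differentiableOn (hv.sub_const a)))
  -- base point `z₀ = (max B 0 + 1)·i`
  obtain ⟨y₀, hy₀⟩ : ∃ y₀ : ℝ, y₀ = max B 0 + 1 := ⟨_, rfl⟩
  have hy₀pos : 0 < y₀ := by rw [hy₀]; have := le_max_right B 0; linarith
  have hy₀B : B < y₀ := by rw [hy₀]; have := le_max_left B 0; linarith
  obtain ⟨z₀, hz₀def⟩ : ∃ z₀ : ℂ, z₀ = (y₀ : ℂ) * Complex.I := ⟨_, rfl⟩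
  have hz₀im : z₀.im = y₀ := by rw [hz₀def]; simp
  have hz₀ : 0 < z₀.im := by rw [hz₀im]; exact hy₀pos
  have hz₀U : z₀ ∈ U := by rw [hUdef]; exact hz₀
  have hgen : ∀ α : ℂ, α ≠ 0 → ∀ β : ℂ, ∀ᶠ z in 𝓝[≠] z₀, α * eichlerIntegral f (ofComplex z) + β ∉ L.lattice :=
    fun α hα β ↦ eventually_eichlerIntegral_affine_notMem f hf0 L hz₀ hα β
  have hU' : ∀ᶠ z in 𝓝 z₀, 0 < z.im := isOpen_upperHalfPlaneSet.mem_nhds hz₀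
  have hB' : ∀ᶠ z in 𝓝 z₀, B < z.im :=
    (isOpen_lt continuous_const Complex.continuous_im).mem_nhds (by simpa [hz₀im] using hy₀B)
  -- Step 3: the squared identity `Ac² = C·Bc²` on all of `U`
  have hsq : Set.EqOn (fun z ↦ Ac z ^ 2 - C * Bc z ^ 2) 0 U := by
    have han : AnalyticOnNhd ℂ (fun z ↦ Ac z ^ 2 - C * Bc z ^ 2) U :=
      ((hAc.pow 2).sub ((hBc.pow 2).const_mul C)).analyticOnNhd hUo
    apply han.eqOn_zero_of_preconnected_of_frequently_eq_zero hconn hz₀U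
    have hev : ∀ᶠ z in 𝓝[≠] z₀, Ac z ^ 2 - C * Bc z ^ 2 = 0 := by
      filter_upwards [hgen c hc0 0, hgen (2 * c) (mul_ne_zero two_ne_zero hc0) 0,
        nhdsWithin_le_nhds hB', nhdsWithin_le_nhds hU'] with z hz1 hz2 hzB hzU
      have hτ : ofComplex z = ⟨z, hzU⟩ := ofComplex_apply_of_im_pos hzU
      obtain ⟨u, hudef⟩ : ∃ u : ℂ, u = c * eichlerIntegral f ⟨z, hzU⟩ := ⟨_, rfl⟩
      have hvz : v z = u := by rw [hvdef, hudef]; simp [hτ]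
      have huΛ : u ∉ L.lattice := by rw [← hvz, hvdef]; simpa using hz1
      have h2u : 2 * u ∉ L.lattice := by rw [← hvz, hvdef]; simpa [mul_assoc] using hz2
      have hσu := hσne u huΛ
      have h℘'u : ℘'[L] u ≠ 0 := L.derivWeierstrassP_ne_zero huΛ h2u
      have hmain := hhyp ⟨z, hzU⟩ hzB (by rw [← hudef]; exact huΛ)
      rw [← hudef] at hmain
      simp only [shortT, shortX, shortY, sigmaSqRoot] at hmain
      rw [← hL, ← hc, ← hf, ← hudef] at hmain
      have hA : Ac z = F ⟨z, hzU⟩ * (c * (℘'[L] u * L.weierstrassSigma u ^ 3)) := by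
        rw [hAdef]; simp only; rw [hτ, hvz, hP₃ u huΛ]
      have hB : Bc z = -2 * G ⟨z, hzU⟩ * (℘[L] u * L.weierstrassSigma u ^ 2 * cexp (e * u / 2) *
          L.weierstrassSigma (u - a)) := by
        rw [hBdef]; simp only; rw [hτ, hvz, hP₂ u huΛ]
      rw [hA, hB, mul_pow, hmain]
      field_simp
      ring
    exact hev.frequently
  -- Step 4: a global square root `Ac = κ₀·Bc` (holomorphic functions on the connected `U` form an integral domain)
  obtain ⟨κ, hκ⟩ := IsAlgClosed.exists_pow_nat_eq C (by norm_num : 0 < 2)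
  have hID : ∀ {g h : ℂ → ℂ}, DifferentiableOn ℂ g U → DifferentiableOn ℂ h U →
      Set.EqOn (g * h) 0 U → Set.EqOn g 0 U ∨ Set.EqOn h 0 U := by
    intro g h hg hh hgh
    by_contra hnot
    push Not at hnot
    obtain ⟨hg0, hh0⟩ := hnot
    obtain ⟨z₁, hz₁U, hgz₁⟩ : ∃ z₁ ∈ U, g z₁ ≠ 0 := by
      by_contra h'
      push Not at h'
      exact hg0 (fun z hz ↦ by simpa using h' z hz)
    apply hh0
    apply (hh.analyticOnNhd hUo).eqOn_zero_of_preconnected_of_eventuallyEq_zero hconn hz₁U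
    have hgc : ContinuousAt g z₁ := hg.continuousOn.continuousAt (hUo.mem_nhds hz₁U)
    filter_upwards [hgc.eventually_ne hgz₁, hUo.mem_nhds hz₁U] with z hz hzU
    have h0 := hgh hzU
    simp only [Pi.mul_apply, Pi.zero_apply, mul_eq_zero] at h0
    simpa using h0.resolve_left hz
  have hlin : ∃ κ₀ : ℂ, κ₀ ^ 2 = C ∧ Set.EqOn (fun z ↦ Ac z - κ₀ * Bc z) 0 U := by
    have hprod : Set.EqOn ((fun z ↦ Ac z - κ * Bc z) * (fun z ↦ Ac z + κ * Bc z)) 0 U := by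
      intro z hz
      have h0 := hsq hz
      simp only [Pi.mul_apply, Pi.zero_apply] at h0 ⊢
      linear_combination h0 - Bc z ^ 2 * hκ
    have hd1 : DifferentiableOn ℂ (fun z ↦ Ac z - κ * Bc z) U := hAc.sub (hBc.const_mul κ)
    have hd2 : DifferentiableOn ℂ (fun z ↦ Ac z + κ * Bc z) U := hAc.add (hBc.const_mul κ)
    rcases hID hd1 hd2 hprod with h | h
    · exact ⟨κ, hκ, h⟩
    · refine ⟨-κ, by rw [neg_sq, hκ], fun z hz ↦ ?_⟩
      have h0 := h hz
      simp only [Pi.zero_apply] at h0 ⊢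
      linear_combination h0
  obtain ⟨κ₀, hκ₀2, hlin⟩ := hlin
  have hκ₀ : κ₀ ≠ 0 := by rintro rfl; apply hC; rw [← hκ₀2]; norm_num
  -- Step 5: a generic point `τ₁` and its translate `γτ₁`
  obtain ⟨zP, hzP, hzP0⟩ := L.exists_weierstrassP_eq 0
  obtain ⟨z₁, hz₁v, hz₁a, hz₁p, hz₁m, hz₁G, hz₁U⟩ := ((hgen c hc0 0).and ((hgen c hc0 (-a)).and
    ((hgen c hc0 zP).and ((hgen c hc0 (-zP)).and ((eventually_ne_zero_of_mdifferentiable G hGd hG hz₀).and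
      (nhdsWithin_le_nhds hU')))))).exists
  have hτ₁ : ofComplex z₁ = ⟨z₁, hz₁U⟩ := ofComplex_apply_of_im_pos hz₁U
  obtain ⟨τ₁, hτ₁def⟩ : ∃ τ₁ : ℍ, τ₁ = ⟨z₁, hz₁U⟩ := ⟨_, rfl⟩
  rw [← hτ₁def] at hτ₁
  have hz₁U' : (τ₁ : ℂ) ∈ U := by rw [hUdef, hτ₁def]; exact hz₁U
  obtain ⟨u, hudef⟩ : ∃ u : ℂ, u = c * eichlerIntegral f τ₁ := ⟨_, rfl⟩
  have hvz₁ : v (τ₁ : ℂ) = u := by rw [hvdef, hudef]; simp [ofComplex_apply]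
  have huΛ : u ∉ L.lattice := by rw [hudef, ← hτ₁]; simpa using hz₁v
  have hua : u - a ∉ L.lattice := by rw [hudef, ← hτ₁, sub_eq_add_neg]; exact hz₁a
  have h℘u : ℘[L] u ≠ 0 := by
    intro h0
    rw [← hzP0] at h0
    rcases (L.weierstrassP_eq_weierstrassP_iff huΛ hzP).mp h0 with h | h
    · exact hz₁p (by rw [hτ₁, ← hudef]; exact h)
    · exact hz₁m (by rw [hτ₁, ← hudef, ← sub_eq_add_neg]; exact h)
  have hGτ₁ : G τ₁ ≠ 0 := by rw [← hτ₁]; exact hz₁G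
  -- the translate
  obtain ⟨τ₂, hτ₂def⟩ : ∃ τ₂ : ℍ, τ₂ = (γ : SL(2, ℤ)) • τ₁ := ⟨_, rfl⟩
  have hz₂U : (τ₂ : ℂ) ∈ U := by rw [hUdef]; exact τ₂.im_pos
  have hE₂ : eichlerIntegral f τ₂ = eichlerIntegral f τ₁ + cuspSymbol f γ := by
    have := eichlerIntegral_smul_sub_holds f γ τ₁
    rw [← hτ₂def] at this
    linear_combination this
  have hvz₂ : v (τ₂ : ℂ) = u + μ := by
    rw [hvdef, hudef, hμdef]; simp [ofComplex_apply, hE₂, mul_add]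
  have huμ : u + μ ∉ L.lattice := fun h ↦ huΛ (by simpa using sub_mem h hμ)
  have huμa : u + μ - a ∉ L.lattice := fun h ↦ hua (by
    have := sub_mem h hμ; rwa [show u + μ - a - μ = u - a by ring] at this)
  obtain ⟨J, hJ0, hF₂, hG₂⟩ := hJ τ₁
  rw [← hτ₂def] at hF₂ hG₂
  obtain ⟨J, hFJ, hGJ, hJ⟩ : ∃ J : ℂ, F τ₂ = J * F τ₁ ∧ G τ₂ = J * G τ₁ ∧ J ≠ 0 := ⟨J, hF₂, hG₂, hJ0⟩
  have h℘μ : ℘[L] (u + μ) = ℘[L] u := L.weierstrassP_add_coe u ⟨μ, hμ⟩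
  have h℘'μ : ℘'[L] (u + μ) = ℘'[L] u := L.derivWeierstrassP_add_coe u ⟨μ, hμ⟩
  -- the two linear relations
  have hr₁ := hlin hz₁U'
  have hr₂ := hlin hz₂U
  simp only [Pi.zero_apply] at hr₁ hr₂
  rw [hAdef, hBdef] at hr₁ hr₂
  simp only at hr₁ hr₂
  rw [ofComplex_apply, hvz₁, hP₃ u huΛ, hP₂ u huΛ] at hr₁
  rw [ofComplex_apply, hvz₂, hP₃ _ huμ, hP₂ _ huμ, h℘μ, h℘'μ, hFJ, hGJ] at hr₂
  have hs₁ := hσne u huΛ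
  have hs₂ := hσne _ huμ
  have hK : 2 * κ₀ * G τ₁ * ℘[L] u ≠ 0 :=
    mul_ne_zero (mul_ne_zero (mul_ne_zero two_ne_zero hκ₀) hGτ₁) h℘u
  have e₁ : F τ₁ * c * ℘'[L] u * L.weierstrassSigma u +
      2 * κ₀ * G τ₁ * ℘[L] u * (cexp (e * u / 2) * L.weierstrassSigma (u - a)) = 0 := by
    have h : L.weierstrassSigma u ^ 2 * (F τ₁ * c * ℘'[L] u * L.weierstrassSigma u +
        2 * κ₀ * G τ₁ * ℘[L] u * (cexp (e * u / 2) * L.weierstrassSigma (u - a))) = 0 := by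
      linear_combination hr₁
    exact (mul_eq_zero.mp h).resolve_left (pow_ne_zero _ hs₁)
  have e₂ : F τ₁ * c * ℘'[L] u * L.weierstrassSigma (u + μ) +
      2 * κ₀ * G τ₁ * ℘[L] u * (cexp (e * (u + μ) / 2) * L.weierstrassSigma (u + μ - a)) = 0 := by
    have h : J * L.weierstrassSigma (u + μ) ^ 2 * (F τ₁ * c * ℘'[L] u * L.weierstrassSigma (u + μ) +
        2 * κ₀ * G τ₁ * ℘[L] u * (cexp (e * (u + μ) / 2) * L.weierstrassSigma (u + μ - a))) = 0 := by
      linear_combination hr₂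
    exact (mul_eq_zero.mp h).resolve_left (mul_ne_zero hJ (pow_ne_zero _ hs₂))
  have key : cexp (e * (u + μ) / 2) * L.weierstrassSigma (u + μ - a) * L.weierstrassSigma u =
      cexp (e * u / 2) * L.weierstrassSigma (u - a) * L.weierstrassSigma (u + μ) := by
    have h : 2 * κ₀ * G τ₁ * ℘[L] u *
        (cexp (e * (u + μ) / 2) * L.weierstrassSigma (u + μ - a) * L.weierstrassSigma u -
          cexp (e * u / 2) * L.weierstrassSigma (u - a) * L.weierstrassSigma (u + μ)) = 0 := by
      linear_combination L.weierstrassSigma u * e₂ - L.weierstrassSigma (u + μ) * e₁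
    exact sub_eq_zero.mp ((mul_eq_zero.mp h).resolve_left hK)
  have hWu : sigmaSqRoot L a e u ≠ 0 := by
    unfold sigmaSqRoot
    exact div_ne_zero (mul_ne_zero (Complex.exp_ne_zero _) (hσne _ hua)) hs₁
  have hWeq : sigmaSqRoot L a e (u + μ) = sigmaSqRoot L a e u := by
    unfold sigmaSqRoot
    rw [div_eq_div_iff hs₂ hs₁]
    exact key
  rw [hρ u] at hWeq
  exact mul_right_cancel₀ hWu (by rw [hWeq, one_mul])

/-- **The landed S4₂ is the special case of modular forms** `F, G ∈ M_k(Γ₀(M))`, `N ∣ M`, `γ ∈ Γ₀(N) ∩ Γ₀(M)` (sanity check of the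
generalisation; `J = j(γ,τ)^k`). [cite: Manin1972, Prop. 1.4 (shape)] -/
theorem sigmaSqRootMonodromy_of_modularForm
    (W : WeierstrassCurve ℚ) [W.IsElliptic] [W.IsGloballyMinimal] {N : ℕ} [NeZero N]
    (D : ModularParametrizationData W N) (a e : ℂ) (M : ℕ) (k : ℤ)
    (F G : ModularForm (Gamma0 M) k) (C : ℂ) (B : ℝ) (hG : G ≠ 0) (hC : C ≠ 0)
    (hhyp : ∀ τ : ℍ, B < τ.im → (D.c : ℂ) * eichlerIntegral D.f τ ∉ D.L.lattice →
      F τ ^ 2 = C * (shortT D τ * sigmaSqRoot D.L a e ((D.c : ℂ) * eichlerIntegral D.f τ)) ^ 2 * G τ ^ 2)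
    (γ : Gamma0 N) (hγM : (γ : SL(2, ℤ)) ∈ Gamma0 M) :
    ∀ w₀ : ℂ, sigmaSqRoot D.L a e (w₀ + (D.c : ℂ) * cuspSymbol D.f γ) = sigmaSqRoot D.L a e w₀ := by
  have hG0 : ∃ τ : ℍ, G τ ≠ 0 := by
    by_contra h
    push Not at h
    exact hG (DFunLike.ext G 0 fun τ ↦ by rw [h τ]; rfl)
  refine sigmaSqRootMonodromy_of_automorphy W D a e F G (ModularFormClass.holo F) (ModularFormClass.holo G) hG0 C B hC
    hhyp γ fun τ ↦ ⟨denom (γ : SL(2, ℤ)) τ ^ k, zpow_ne_zero k (denom_ne_zero _ τ), ?_, ?_⟩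
  · exact SlashInvariantForm.slash_action_eqn_SL'' F hγM τ
  · exact SlashInvariantForm.slash_action_eqn_SL'' G hγM τ

end Summit.BirchSwinnertonDyer.BirchSwinnertonDyer.Theorems.ManinLocalTwoThree.EvenKummerCongruence

end
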